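import Summits.AtomisticToContinuum.Crystallization.Theorems.ChargedEnergyGapBlockCharging
import Summits.AtomisticToContinuum.Crystallization.Theorems.ChargedEnergyGapBarlowTubeH
import Summits.AtomisticToContinuum.Crystallization.Theorems.ChargedEnergyGapBulkCarrier
import HarnessLib

/-!
# Charged energy gap — lens-3 g65, node «BarlowRef» (R3) — part 25 «TubeCharging»: the residual of record FROM the cored share bounds (item 1, closed)

Cell `decomp-a2c`, seat lens-3, generation 65.  Imports part 24 (`…BlockCharging`), the tree's part 6 (`…BarlowTubeH`: `TubeShareBoundH`, the prover
target of record) and P-Z₅c (`…BulkCarrier`: `le_infDist_of_profileWeight_eq_one`).  ELEMENTARY·PROVED consumer glue + ONE typed geometric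
existence statement (the EXHIBITION), which is what remains of item 4.

* `TubeBlockExhibition s lam ℓ₀ μ₀ ϱ ϱχ r Rb B_T B_χ B_H I ϱc ℓ b θ` — for every instance of (H𝄪ˢ) (the binders of `BulkFarResidueBoundB`): a
  block assignment `Blk`, equivariant on live pairs of points, and a BAND label (periodic on `P.points`, values in the finite index set `I` on
  members; band `i` carries the parameters `(ϱc i, ℓ i, b i, θ i)` of ONE cored share bound `TubeShareBoundH s r (ϱc i) (ℓ i) (b i) Rb (θ i)`), such
  that for every live pair (bulk source `y`, far target `z ≠ y`) of points: `Blk y z ⊆ P.points`; every member `c` lies within `r` of the segment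
  `[y, z]` (TUBE), has a CORE POINT `x₀` with `dist c x₀ ≤ ℓ (band c)` from which every bulk source keeps distance `≥ ϱc (band c)`, keeps CLEARANCE
  `b (band c)` from every far target; and the BUDGET INEQUALITY `#(P.points ∩ B̄(q, Rb)) ≤ Σ_{c ∈ Blk y z} chargeBudget c / θ (band c)` holds for
  some site `q`.  Intended bands (record design, g64 MEMO §3 cases H/D/W): SHELL/TRANSITION members (`c ∉ X` paying, `B_T`/`B_χ` budget): `x₀ ∈ C`,
  `ϱc = ϱ` by `IsBulkSource.le_dist` (`w_C(y) = 1`), `b = 3ϱ/8` by `IsFarTarget.le_dist`; HOLE members (`c ∈ X` priced, `B_H` budget): `x₀ = c`,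
  `ℓ = 0`, `ϱc = 0`, `b = 3ϱ/8 − 18` by `IsFarTarget.le_dist_of_near` (a paying site within `18`) — and since `B_H ≥ 0` is FREE in the record consumer,
  `B_H := θ_hole · N_max` makes a SINGLE priced excised member a valid hole block.  For a block containing every site of the ball with member rates
  `θ (band c) ≤ chargeBudget c` the budget inequality is automatic (`ballCount_le_sum_budget_div`, uniform shares).
* ★★ `bulkFarResidueBoundB_of_tubeBlockExhibition` — EXHIBITION + `TubeShareBoundH s r (ϱc i) (ℓ i) (b i) Rb (θ i)` for every band `i ∈ I`
  (with `b i ≤ 3ϱ/8`, `θ > 0`) ⟹ `BulkFarResidueBoundB s lam ℓ₀ μ₀ ϱ ϱχ B_T B_χ B_H`.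
  PROOF: part 24 with rates `Λr c = θ (band c) · N_*`, `N_* = min_{q ∈ F+Λ} #(P.points ∩ B̄(q, Rb))` (attained, `≥ 1`): the harmonic criterion is
  the budget inequality divided by `N_* ≤ N_q`; the load of a motif carrier `c₀` over a finite set `Q` of live pairs through it is
  `≤ tubeLoad r c₀ F G` with `F`/`G` the sources/targets of `Q` (members lie in the `r`-tube), and the band's share bound applies at the member's
  core point (sources keep `ϱc` from it, targets keep `b` from `c₀` and `3ϱ/8 ≥ b` from the paying sources, `IsFarTarget.le_dist`).
* ★★ `bulkFarResidueBoundB_record_of_tubeBlockExhibition` / `rotationFamilyB_record_of_tubeBlockExhibition` — the record dials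
  `(3/5, 1/3, 3, 1/100, 160, 80; r = 101/5, Rb = 18; B_T = 1/2100, B_χ = 1/46, B_H ≥ 0 free)`, any finite band table with clearances `b i ≤ 60`.

BUDGET TABLE (forecast for the record exhibition's SHELL blocks `Blk = P.points ∩ B̄(q, 18)`, clean `T`-members at levels `122 ≤ ℓ ≤ 158`, bands
`(ϱc, ℓ, b) = (160, ℓ_i, 60)`; g64 cert65 `num/cert65.out` + part 22): the certificate target is `θ(ℓ)·N ≤ θ̂(ℓ)·B_T·N` with
`θ̂(ℓ) ≤ 0.496/0.480/0.406/0.307/0.225/0.157/0.101/0.081` at `ℓ = 159.5/159/155/150/145/140/130/122` (sources `a ≤ 2·10⁴`) `+ 0.0154` (all farther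
sources, part 22 `tubeLoad_far_record_share`, typed) — every entry `< 1`, so `θ(band c) ≤ B_T = chargeBudget c` member by member and the budget
inequality holds with UNIFORM shares (`ballCount_le_sum_budget_div`); the harmonic statistic of the worst block is `0.348 + 0.015`.  HOLE blocks:
one band `(0, 0, 42, θ_hole)` with any finite `θ_hole` (free `B_H`).

0 sorry; standard axioms.
-/

noncomputable section

open scoped Classical

open Literature.MathematicalPhysics.StatisticalMechanics Literature.Geometry.DiscreteGeometry
open Summit.AtomisticToContinuum.Crystallization.Theses.PricedLinkCensus
open Summit.AtomisticToContinuum.Crystallization.Theorems.ChargedEnergyGapNegative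

namespace Summit.AtomisticToContinuum.Crystallization.Theorems.ChargedEnergyGapChartDial

section TubeCharging

variable (ϱχ : ℝ) {m : ℕ} (D : Fin m → Set E3) (σ : Fin m → Bool) (P : PeriodicConfiguration 3) (X : Set E3) (ϱ : ℝ) (C : Set E3)

/-! ### Live-pair geometry: sources avoid the core ball, far targets avoid paying sites -/

variable {ϱχ D σ P X ϱ C} in
/-- A bulk source is a PAYING site: non-excised with `χ_σ·w_C > 0`. -/
theorem IsBulkSource.paying {y : E3} (h : IsBulkSource ϱχ D σ X ϱ C y) : y ∉ X ∧ 0 < localFactor ϱχ D σ y * profileWeight ϱ C y := by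
  refine ⟨h.1, ?_⟩
  rw [h.2.1, mul_one]
  exact h.2.2.2

variable {ϱχ D σ P X ϱ C} in
/-- A bulk source lies outside the open core ball: `ϱ ≤ dist y x₀` for every `x₀ ∈ C` (`w_C(y) = 1`). -/
theorem IsBulkSource.le_dist {y x₀ : E3} (h : IsBulkSource ϱχ D σ X ϱ C y) (hϱ : 0 < ϱ) (hx₀ : x₀ ∈ C) : ϱ ≤ dist y x₀ :=
  (le_infDist_of_profileWeight_eq_one hϱ h.2.1).trans (Metric.infDist_le_dist_of_mem hx₀)

variable {ϱχ D σ P X ϱ C} in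
/-- A far target keeps distance `≥ 3ϱ/8` from every paying site. -/
theorem IsFarTarget.le_dist {z y : E3} (hz : IsFarTarget ϱχ D σ P X ϱ C z) (hy : y ∈ P.points) (hyX : y ∉ X)
    (hpos : 0 < localFactor ϱχ D σ y * profileWeight ϱ C y) : 3 * ϱ / 8 ≤ dist z y := by
  by_contra h
  rw [not_le] at h
  exact hz.2 ⟨y, hy, hyX, hpos, h⟩

variable {ϱχ D σ P X ϱ C} in
/-- A far target keeps distance `≥ 3ϱ/8 − Rb` from every point having a paying site within `Rb`. -/
theorem IsFarTarget.le_dist_of_near {z c q : E3} {Rb : ℝ} (hz : IsFarTarget ϱχ D σ P X ϱ C z) (hq : q ∈ P.points) (hqX : q ∉ X)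
    (hpos : 0 < localFactor ϱχ D σ q * profileWeight ϱ C q) (hcq : dist c q ≤ Rb) : 3 * ϱ / 8 - Rb ≤ dist z c := by
  have h1 := hz.le_dist hq hqX hpos
  have h2 := dist_triangle z c q
  linarith

/-! ### The load of a carrier through a finite set of live pairs is a tube load -/

/-- `Σ_{p ∈ Q} d_p⁻⁶ ≤ tubeLoad r c₀ (sources Q) (targets Q)` when every pair of `Q` is proper and has `c₀` in its `r`-tube. -/
theorem sum_inv6_le_tubeLoad (r : ℝ) (c₀ : E3) (Q : Finset (E3 × E3))
    (hQ : ∀ p ∈ Q, p.2 ≠ p.1 ∧ Metric.infDist c₀ (segment ℝ p.1 p.2) ≤ r) :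
    ∑ p ∈ Q, (dist p.1 p.2)⁻¹ ^ 6 ≤ tubeLoad r c₀ (Q.image Prod.fst) (Q.image Prod.snd) := by
  set f : E3 × E3 → ℝ := fun p => if p.1 ≠ p.2 ∧ Metric.infDist c₀ (segment ℝ p.1 p.2) ≤ r then (dist p.1 p.2)⁻¹ ^ 6 else 0 with hf
  have htube : tubeLoad r c₀ (Q.image Prod.fst) (Q.image Prod.snd) = ∑ p ∈ Q.image Prod.fst ×ˢ Q.image Prod.snd, f p := by
    unfold tubeLoad
    rw [Finset.sum_product]
  have hQf : ∀ p ∈ Q, (dist p.1 p.2)⁻¹ ^ 6 = f p := by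
    intro p hp
    simp only [hf]
    rw [if_pos ⟨(hQ p hp).1.symm, (hQ p hp).2⟩]
  have hf0 : ∀ p, 0 ≤ f p := by
    intro p
    simp only [hf]
    split_ifs <;> positivity
  rw [htube, Finset.sum_congr rfl hQf]
  exact Finset.sum_le_sum_of_subset_of_nonneg Finset.subset_product fun p _ _ => hf0 p

variable {ϱχ D σ P X ϱ C} in
/-- ★ **THE LOAD OF A CORED CARRIER FROM THE SHARE BOUND**: `TubeShareBoundH s r ϱ' ℓc b₀ Rb θ`, a carrier `c₀` within `ℓc` of a core point
`x₀` from which every bulk source keeps distance `≥ ϱ'`, at distance `≥ b₀` (`b₀ ≤ 3ϱ/8`) from every far target, and a finite set `Q` of live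
pairs of points with `c₀` in their `r`-tubes ⟹ `Σ_{p ∈ Q} d_p⁻⁶ ≤ θ · #(P.points ∩ B̄(q, Rb))` for every site `q`. -/
theorem sum_inv6_le_of_tubeShareBoundH {s r ϱ' ℓc b₀ Rb θ : ℝ} (hTS : TubeShareBoundH s r ϱ' ℓc b₀ Rb θ) (hb₀ : b₀ ≤ 3 * ϱ / 8)
    (hsep : IsSeparatedRef s P) (hBar : IsBarlowImage P.points) {c₀ x₀ q : E3} (hcx : dist c₀ x₀ ≤ ℓc)
    (hsrc : ∀ y ∈ P.points, IsBulkSource ϱχ D σ X ϱ C y → ϱ' ≤ dist y x₀) (hq : q ∈ P.points)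
    (hclear : ∀ z ∈ P.points, IsFarTarget ϱχ D σ P X ϱ C z → b₀ ≤ dist z c₀) (Q : Finset (E3 × E3))
    (hQ : ∀ p ∈ Q, p.1 ∈ P.points ∧ p.2 ∈ P.points ∧ IsBulkSource ϱχ D σ X ϱ C p.1 ∧ IsFarTarget ϱχ D σ P X ϱ C p.2 ∧ p.2 ≠ p.1 ∧
      Metric.infDist c₀ (segment ℝ p.1 p.2) ≤ r) :
    ∑ p ∈ Q, (dist p.1 p.2)⁻¹ ^ 6 ≤ θ * ((P.points ∩ Metric.closedBall q Rb).ncard : ℝ) := by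
  refine (sum_inv6_le_tubeLoad r c₀ Q fun p hp => ⟨(hQ p hp).2.2.2.2.1, (hQ p hp).2.2.2.2.2⟩).trans
    (hTS P hsep hBar x₀ c₀ q (Q.image Prod.fst) (Q.image Prod.snd) ?_ ?_ hq hcx ?_ ?_ ?_)
  · intro y hy
    obtain ⟨p, hp, rfl⟩ := Finset.mem_image.1 (Finset.mem_coe.1 hy)
    exact (hQ p hp).1
  · intro z hz
    obtain ⟨p, hp, rfl⟩ := Finset.mem_image.1 (Finset.mem_coe.1 hz)
    exact (hQ p hp).2.1
  · intro y hy
    obtain ⟨p, hp, rfl⟩ := Finset.mem_image.1 hy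
    exact hsrc _ (hQ p hp).1 (hQ p hp).2.2.1
  · intro z hz
    obtain ⟨p, hp, rfl⟩ := Finset.mem_image.1 hz
    exact hclear _ (hQ p hp).2.1 (hQ p hp).2.2.2.1
  · intro y hy z hz
    obtain ⟨p, hp, rfl⟩ := Finset.mem_image.1 hy
    obtain ⟨p', hp', rfl⟩ := Finset.mem_image.1 hz
    have hpay := (hQ p hp).2.2.1.paying
    have := (hQ p' hp').2.2.2.1.le_dist (hQ p hp).1 hpay.1 hpay.2
    rw [dist_comm] at this
    exact hb₀.trans this

/-! ### The exhibition and the consumer -/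

/-- UNIFORM SHARES SUFFICE: if the block contains every site of the ball `B̄(q, Rb)` and each member's rate is at most its budget, the budget
inequality `#(P.points ∩ B̄(q, Rb)) ≤ Σ_{c ∈ Blk} β c / θ c` holds. -/
theorem ballCount_le_sum_budget_div {q : E3} {Rb : ℝ} (Blk : Finset E3) (β θ : E3 → ℝ)
    (hball : P.points ∩ Metric.closedBall q Rb ⊆ ↑Blk) (hθ : ∀ c ∈ Blk, 0 < θ c) (hle : ∀ c ∈ Blk, θ c ≤ β c) :
    ((P.points ∩ Metric.closedBall q Rb).ncard : ℝ) ≤ ∑ c ∈ Blk, β c / θ c := by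
  calc ((P.points ∩ Metric.closedBall q Rb).ncard : ℝ) ≤ (Blk.card : ℝ) := by
        exact_mod_cast (Set.ncard_le_ncard hball Blk.finite_toSet).trans_eq (Set.ncard_coe_finset Blk)
    _ = ∑ _c ∈ Blk, (1 : ℝ) := by rw [Finset.sum_const, nsmul_eq_mul, mul_one]
    _ ≤ ∑ c ∈ Blk, β c / θ c := Finset.sum_le_sum fun c hc => (one_le_div (hθ c hc)).2 (hle c hc)

/-- piece TUBE-BLOCK-EXHIBITION · UNDECIDED (record design: g64 MEMO §3, cases H/D/W; forecast: the budget table above) · ATTACKABLE·M ·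
**THE TUBE BLOCK EXHIBITION**: for every instance of (H𝄪ˢ) — the binders of `BulkFarResidueBoundB` — there are a block assignment `Blk`, equivariant
on live pairs of points, and a band label, periodic on `P.points`, such that for every live pair (bulk source `y`, far target `z ≠ y`) of points:
`Blk y z ⊆ P.points`; every member `c` has `band c ∈ I`, lies within `r` of the segment `[y, z]`, has a core point `x₀` with `dist c x₀ ≤ ℓ (band c)`
from which every bulk source of `P` keeps distance `≥ ϱc (band c)`, and keeps clearance `b (band c)` from every far target of `P`; and the BUDGET
INEQUALITY `#(P.points ∩ B̄(q, Rb)) ≤ Σ_{c ∈ Blk y z} chargeBudget c / θ (band c)` holds for some site `q`. -/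
def TubeBlockExhibition (s lam ℓ₀ μ₀ ϱ ϱχ r Rb B_T B_χ B_H : ℝ) {ι : Type*} (I : Finset ι) (ϱc ℓ b θ : ι → ℝ) : Prop :=
  ∀ (P : PeriodicConfiguration 3) (C X : Set E3) (m : ℕ) (D : Fin m → Set E3) (σ : Fin m → Bool),
    IsSeparatedRef s P → IsLabelledRef lam ℓ₀ P → IsBarlowImage P.points → IsForceFree P → IsSiteStressFree P → HarmStableModRot μ₀ P →
    IsInvariantSet P C → IsInvariantSet P X → (∀ i, IsInvariantSet P (D i)) →
    ∃ (Blk : E3 → E3 → Finset E3) (band : E3 → ι),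
      (∀ g ∈ P.lattice, ∀ y ∈ P.points, ∀ z ∈ P.points, IsBulkSource ϱχ D σ X ϱ C y → IsFarTarget ϱχ D σ P X ϱ C z → z ≠ y →
        Blk (y + g) (z + g) = (Blk y z).image (· + g)) ∧
      (∀ g ∈ P.lattice, ∀ c ∈ P.points, band (c + g) = band c) ∧
      ∀ y ∈ P.points, ∀ z ∈ P.points, IsBulkSource ϱχ D σ X ϱ C y → IsFarTarget ϱχ D σ P X ϱ C z → z ≠ y →
        (↑(Blk y z) : Set E3) ⊆ P.points ∧
        (∀ c ∈ Blk y z, band c ∈ I ∧ Metric.infDist c (segment ℝ y z) ≤ r ∧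
          (∃ x₀ : E3, dist c x₀ ≤ ℓ (band c) ∧ ∀ y' ∈ P.points, IsBulkSource ϱχ D σ X ϱ C y' → ϱc (band c) ≤ dist y' x₀) ∧
          (∀ z' ∈ P.points, IsFarTarget ϱχ D σ P X ϱ C z' → b (band c) ≤ dist z' c)) ∧
        ∃ q ∈ P.points, ((P.points ∩ Metric.closedBall q Rb).ncard : ℝ) ≤
          ∑ c ∈ Blk y z, chargeBudget ϱχ D σ P X ϱ C B_T B_χ B_H c / θ (band c)

/-- ★★ **THE RESIDUAL FROM THE EXHIBITION AND THE CORED SHARE BOUNDS (item 1 closed).**  `TubeBlockExhibition …` + for every band `i ∈ I` the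
share bound `TubeShareBoundH s r (ϱc i) (ℓ i) (b i) Rb (θ i)` with clearance `b i ≤ 3ϱ/8` and rates `θ > 0`
⟹ `BulkFarResidueBoundB s lam ℓ₀ μ₀ ϱ ϱχ B_T B_χ B_H`. -/
theorem bulkFarResidueBoundB_of_tubeBlockExhibition {s lam ℓ₀ μ₀ ϱ ϱχ r Rb B_T B_χ B_H : ℝ} {ι : Type*} {I : Finset ι} {ϱc ℓ b θ : ι → ℝ}
    (hs : 0 < s) (hRb : 0 ≤ Rb) (hBT : 0 ≤ B_T) (hBχ : 0 ≤ B_χ) (hBH : 0 ≤ B_H) (hθ : ∀ i, 0 < θ i) (hb : ∀ i ∈ I, b i ≤ 3 * ϱ / 8)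
    (hE : TubeBlockExhibition s lam ℓ₀ μ₀ ϱ ϱχ r Rb B_T B_χ B_H I ϱc ℓ b θ)
    (hTS : ∀ i ∈ I, TubeShareBoundH s r (ϱc i) (ℓ i) (b i) Rb (θ i)) :
    BulkFarResidueBoundB s lam ℓ₀ μ₀ ϱ ϱχ B_T B_χ B_H := by
  intro P C X m D σ hsep hlab hBar hff hss hst hC hX hD
  obtain ⟨Blk, band, hBlk, hband, hpair⟩ := hE P C X m D σ hsep hlab hBar hff hss hst hC hX hD
  -- the minimal ball count `N_*`, attained at a site `qs`
  set S : Set ℕ := (fun q => (P.points ∩ Metric.closedBall q Rb).ncard) '' P.points with hS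
  obtain ⟨q₁, hq₁⟩ := P.points_nonempty
  have hSne : S.Nonempty := ⟨_, q₁, hq₁, rfl⟩
  obtain ⟨qs, hqs, hqsN⟩ := Nat.sInf_mem hSne
  have hmin : ∀ q ∈ P.points, sInf S ≤ (P.points ∩ Metric.closedBall q Rb).ncard := fun q hq => Nat.sInf_le ⟨q, hq, rfl⟩
  have hN1 : 1 ≤ sInf S := by
    rw [← hqsN]
    exact (Set.ncard_pos (hsep.finite_inter_closedBall hs qs Rb)).2 ⟨qs, hqs, Metric.mem_closedBall_self hRb⟩
  have hNpos : (0 : ℝ) < (sInf S : ℕ) := by exact_mod_cast hN1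
  refine bulkFarResidue_le_budget_of_blocks ϱχ σ ϱ hBT hBχ hBH hX hC hD Blk (fun c => θ (band c) * (sInf S : ℕ)) hBlk
    (fun g hg c hc => by simp only [hband g hg c hc]) (fun c _ => mul_pos (hθ _) hNpos) (fun y hy z hz hb' hf hne => (hpair y hy z hz hb' hf hne).1) ?_ ?_
  · -- the harmonic criterion = the budget inequality divided by `N_* ≤ N_q`
    intro y hy z hz hb' hf hne
    obtain ⟨-, -, q, hq, hbudget⟩ := hpair y hy z hz hb' hf hne
    have hrw : ∑ c ∈ Blk y z, chargeBudget ϱχ D σ P X ϱ C B_T B_χ B_H c / (θ (band c) * (sInf S : ℕ)) =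
        (∑ c ∈ Blk y z, chargeBudget ϱχ D σ P X ϱ C B_T B_χ B_H c / θ (band c)) / (sInf S : ℕ) := by
      rw [Finset.sum_div]
      exact Finset.sum_congr rfl fun c _ => (div_div _ _ _).symm
    rw [hrw, one_le_div hNpos]
    calc ((sInf S : ℕ) : ℝ) ≤ ((P.points ∩ Metric.closedBall q Rb).ncard : ℝ) := by exact_mod_cast hmin q hq
      _ ≤ _ := hbudget
  · -- the load of a motif carrier through a finite set of live pairs
    intro c₀ hc₀ Q hQ
    rcases Q.eq_empty_or_nonempty with hQe | ⟨p₀, hp₀⟩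
    · rw [hQe, Finset.sum_empty]
      exact (mul_pos (hθ _) hNpos).le
    obtain ⟨hy₀, hz₀, hb₀, hf₀, hne₀, hc₀B⟩ := hQ p₀ hp₀
    obtain ⟨-, hmem, -⟩ := hpair _ hy₀ _ hz₀ hb₀ hf₀ hne₀
    obtain ⟨hband₀, -, ⟨x₀, hcx, hsrc⟩, hclear⟩ := hmem c₀ hc₀B
    have hQ' : ∀ p ∈ Q, p.1 ∈ P.points ∧ p.2 ∈ P.points ∧ IsBulkSource ϱχ D σ X ϱ C p.1 ∧ IsFarTarget ϱχ D σ P X ϱ C p.2 ∧ p.2 ≠ p.1 ∧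
        Metric.infDist c₀ (segment ℝ p.1 p.2) ≤ r := by
      intro p hp
      obtain ⟨hy, hz, hb', hf, hne, hcB⟩ := hQ p hp
      exact ⟨hy, hz, hb', hf, hne, ((hpair _ hy _ hz hb' hf hne).2.1 c₀ hcB).2.1⟩
    rw [← hqsN]
    exact sum_inv6_le_of_tubeShareBoundH (hTS _ hband₀) (hb _ hband₀) hsep hBar hcx hsrc hqs hclear Q hQ'

/-- ★★ **THE RESIDUAL OF RECORD FROM THE EXHIBITION AND THE SHARE BOUNDS AT THE RECORD DIALS** (`s = 3/5`, `r = 101/5`, `ϱ = 160`, `Rb = 18`;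
`B_T = 1/2100`, `B_χ = 1/46`, `B_H ≥ 0` free; any finite band table `(ϱc, ℓ, b, θ)` with clearances `b ≤ 60` and rates `θ > 0`). -/
theorem bulkFarResidueBoundB_record_of_tubeBlockExhibition {ι : Type*} {I : Finset ι} {ϱc ℓ b θ : ι → ℝ} {B_H : ℝ} (hBH : 0 ≤ B_H)
    (hθ : ∀ i, 0 < θ i) (hb : ∀ i ∈ I, b i ≤ 60)
    (hE : TubeBlockExhibition (3 / 5) (1 / 3) 3 (1 / 100) 160 80 (101 / 5) 18 (1 / 2100) (1 / 46) B_H I ϱc ℓ b θ)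
    (hTS : ∀ i ∈ I, TubeShareBoundH (3 / 5) (101 / 5) (ϱc i) (ℓ i) (b i) 18 (θ i)) :
    BulkFarResidueBoundB (3 / 5) (1 / 3) 3 (1 / 100) 160 80 (1 / 2100) (1 / 46) B_H :=
  bulkFarResidueBoundB_of_tubeBlockExhibition (by norm_num) (by norm_num) (by norm_num) (by norm_num) hBH hθ
    (fun i hi => (hb i hi).trans (by norm_num)) hE hTS

/-- ★★ … hence the excised rotation family of record, (R3) node «BarlowRef» (via `rotationFamilyB_record_of_bulkBoundB`, P-Z₅). -/
theorem rotationFamilyB_record_of_tubeBlockExhibition {ι : Type*} {I : Finset ι} {ϱc ℓ b θ : ι → ℝ} {B_H : ℝ} (hBH : 0 ≤ B_H)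
    (hθ : ∀ i, 0 < θ i) (hb : ∀ i ∈ I, b i ≤ 60)
    (hE : TubeBlockExhibition (3 / 5) (1 / 3) 3 (1 / 100) 160 80 (101 / 5) 18 (1 / 2100) (1 / 46) B_H I ϱc ℓ b θ)
    (hTS : ∀ i ∈ I, TubeShareBoundH (3 / 5) (101 / 5) (ϱc i) (ℓ i) (b i) 18 (θ i)) :
    RotationFamilyB (3 / 5) (1 / 3) 3 (1 / 100) (3 / 100) (1 / 2) 160 (2 / 5) 3 (1 / 3000000) 80 (1 / 100000) :=
  rotationFamilyB_record_of_bulkBoundB hBH (bulkFarResidueBoundB_record_of_tubeBlockExhibition hBH hθ hb hE hTS)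

end TubeCharging

end Summit.AtomisticToContinuum.Crystallization.Theorems.ChargedEnergyGapChartDial
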